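import Mathlib
import Literature.MathematicalPhysics.QuantumFieldTheory.Balaban1983to89.T4AveragingDeficitTwoLevel

/-!
# T4AveragingDeficitRate — NE3's statement shape in the abelian model, fully closed: the block average of the TWO-LEVEL constrained minimiser and the ONE-LEVEL constrained minimiser of the quadratic abelian action differ, in the coarse curvature-energy seminorm, by `O(K)` with constants depending on `d` and `n = L` only (cell `pub-balaban`, T4-DAG node U1 (b), spine estimate NE3, row T4-U1b.NE3-PROVE-P2d*, GEN 4; [folklore] glue)

HONEST FRAMING (cell `pub-balaban`, T4-DAG PAGE 1).  The cell's T4 target is the existence AND uniqueness of the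
continuum limit of Bałaban's unit-scale averaged loop expectations on a FINITE torus T⁴ — strictly beyond ultraviolet
stability; NO mass gap statement, NOT the Clay problem, NOT summit progress.  This file is GLUE of the NE3
energy-convexity seat (P2) and closes the seat's two-step argument IN THE LINEAR ABELIAN MODEL.  NE3 (U1 (b)) says:
the minimiser of the fine action under the COMPOSITE (two-level) averaging constraint, once averaged, is close to the
minimiser of the coarse (one-level) constrained problem, with an explicit rate (B11 §E, (115)–(121), Prop. 6).  The
energy route is: (R2ᴱ) the averaged fine minimiser is an approximate critical point of the coarse problem, residual
small in the DUAL energy norm — proved in the model by `T4AveragingDeficitTwoLevel.coarseResidual_twoLevel`; (R1ᴱ)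
strict convexity of the coarse functional converts a dual-norm residual into an energy-norm distance.  For the
QUADRATIC abelian coarse action `actCtot` step (R1ᴱ) is an identity: `actCtot (B + φ) = actCtot B + D actCtot(B)[φ]
+ actCtot φ` with `actCtot φ = 2 n^d ⟨∂₁φ, ∂₁φ⟩` (`actCtot_add`, `actCtot_eq_d1Sq`), so `D actCtot(B + φ)[φ] −
D actCtot(B)[φ] = 4 n^d ⟨∂₁φ, ∂₁φ⟩` — strong convexity with modulus `4 n^d` in the curvature-energy seminorm,
uniformly in everything.  Combining with Fermat for the ONE-LEVEL minimiser `B₁` of `actCtot` on `{B : Q′B = V′}`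
(`dActCtot_eq_zero_of_isMinOn`; no coarse gauge condition is needed — the curvature energy is blind to closed
directions) and with (R2ᴱ) applied to `φ = Qu − B₁ ∈ ker Q′` gives THE RATE THEOREM `energyDist_twoLevel_oneLevel`:

  `⟨∂₁(Qu − B₁), ∂₁(Qu − B₁)⟩^{1/2} ≤ d² · √(2 n^d γ₁(d)) · (2√(6(d+2)) n² K) / (4 n^d)`

for `u` any minimiser of the total fine action `actFtot` on the admissible set `{w : Q′(Qw) = V′ ∧ R∂ᴴw = 0}` lying in
`critSet μ ν K` for every plane, and `B₁` any minimiser of `actCtot` on `{B : Q′B = V′}` — `Q′` ANY complex matrix on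
coarse fields, `V′` any datum.  In words: modulo closed (in particular gauge) directions, to which the curvature energy
is blind, THE TWO MINIMISERS AGREE UP TO `O(K)`, where `K` is the curvature-gradient level of the fine minimiser; in
Bałaban's units `K ∝` (coarse spacing) × ‖∇F‖, i.e. the η-RATE.  This is the statement SHAPE of NE3 with every
constant explicit, for the quadratic abelian action and the linear block average; the squared form is
`d1Sq_twoLevel_oneLevel`.  The only free datum is `K`: for Bałaban's minimisers it is the printed-type regularity input
((9)ˢᵘᵖ + (10), B11 pp. 278–279; record (3.8)), asserted nowhere in this package.  NE3 itself (non-linear average (15),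
SU(N) fields, B11's `H_k(U)`) and the cell's conditionals (BetaPertH, (B), (B^μ)) are not touched.

CITATION HEADER (lean-in-tree rule 2026-08-18).  No sentence of any paper is used as a hypothesis.  Context only:
T. Bałaban, Commun. Math. Phys. **102** (1985) 277–309 [Balaban1985Variational] («B11»: (7)–(10) pp. 278–279;
(75)–(76) p. 289; §E (115)–(121) p. 295 and Prop. 6 — the comparison of minimisers of composite and one-step
constraints); T. Bałaban, Commun. Math. Phys. **95** (1984) 17–40 [Balaban1984PropagatorsI] («B5»: (1.18) p. 20 the
average; (1.66)–(1.67) p. 29 the curvature energy `⟨∂₁B, ∂₁B⟩`; (1.103) p. 34 `H_k`).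
[cite: Balaban1985Variational, (7)–(10) pp. 278–279, (75)–(76) p. 289, (115)–(121) p. 295 (context only);
Balaban1984PropagatorsI, (1.18) p. 20, (1.66)–(1.67) p. 29, (1.103) p. 34 (definitions / context)]

WHAT IS PROVED (all [folklore], sorry-free).  §1 the exact quadratic structure of the coarse action: `rin_add_left`,
`actC_add_smul`, `actC_add`, `dActC_add_base`, `dActC_self`, `actCtot_add`, `dActCtot_add_base`, `dActCtot_self`,
`actCtot_eq_d1Sq` (`actCtot φ = 2 n^d ⟨∂₁φ, ∂₁φ⟩`, via tree `Beta.Ineq167Operator.d1Sq_eq_Fs`), `actCtot_nonneg`,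
`coarseEnergyNorm_sq`, `dActCtot_strongConvex` (`D actCtot(B + φ)[φ] − D actCtot(B)[φ] = 4 n^d ⟨∂₁φ, ∂₁φ⟩`).
§2 the one-level coarse problem: `admissibleC Q′ V′ = {B : Q′B = V′}`, `admissibleC_line`, Fermat
`dActCtot_eq_zero_of_minAlong`, `dActCtot_eq_zero_of_isMinOn`.  §3 THE RATE THEOREM `energyDist_twoLevel_oneLevel`,
its squared form `d1Sq_twoLevel_oneLevel`, and non-vacuity `energyDist_twoLevel_oneLevel_nonvacuous` (`V′ = 0`:
`u = 0`, `B₁ = 0` are admissible minimisers).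

NOT CLAIMED.  Existence/uniqueness of minimisers for general data `(Q′, V′)` (finite-dimensional quadratic
minimisation on an affine subspace; uniqueness genuinely fails without gauge conditions and the theorem does not need
it); anything about Bałaban's non-linear average (15), SU(N)-valued fields, his minimisers `U_k(V)`, their regularity
(9)–(10), B11's `H_k(U)`/`𝔊`, Appendix ML, β for his `𝓓` (GAPS G-ne3p2-1, [analysis]), or NE3.  Record:
HOME/t4/T4-EST-NE3-P2.md v1.22 §0 (r).
-/

set_option autoImplicit false

namespace Literature.MathematicalPhysics.QuantumFieldTheory.Balaban1983to89.T4AveragingDeficitRate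

open scoped BigOperators Matrix ComplexConjugate
open Finset Complex
open Literature.MathematicalPhysics.QuantumFieldTheory.Balaban1983to89.B5Prop11Plancherel
open Literature.MathematicalPhysics.QuantumFieldTheory.Balaban1983to89.B5Block118
open Literature.MathematicalPhysics.QuantumFieldTheory.Balaban1983to89.B5AverageCurlStokes
open Literature.MathematicalPhysics.QuantumFieldTheory.Balaban1983to89.B5Action121
open Literature.MathematicalPhysics.QuantumFieldTheory.Balaban1983to89.B5Value126
open Literature.MathematicalPhysics.QuantumFieldTheory.Balaban1983to89.B5Bounds167Lattice
open Literature.MathematicalPhysics.QuantumFieldTheory.Balaban1983to89.T4AveragingDeficit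
open Literature.MathematicalPhysics.QuantumFieldTheory.Balaban1983to89.T4AveragingDeficitBridge
open Literature.MathematicalPhysics.QuantumFieldTheory.Balaban1983to89.T4AveragingDeficitGaugeLift
open Literature.MathematicalPhysics.QuantumFieldTheory.Balaban1983to89.T4AveragingDeficitTwoLevel
open Literature.MathematicalPhysics.QuantumFieldTheory.Balaban1983to89.T4ConvexResponse
open Literature.MathematicalPhysics.QuantumFieldTheory.Balaban1983to89.Beta.FluctuationProjection
open Literature.MathematicalPhysics.QuantumFieldTheory.Balaban1983to89.Beta.Ineq167OperatorUpper

noncomputable section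

variable {d : ℕ} (n : ℕ) [NeZero n] (M : Fin d → ℕ) [hM : ∀ μ, NeZero (M μ)]

/-! ## §1 The exact quadratic structure of the coarse action -/

/-- `Re(conj (a + a') b) = Re(conj a b) + Re(conj a' b)`. [folklore] -/
theorem rin_add_left (a a' b : ℂ) : rin (a + a') b = rin a b + rin a' b := by
  rw [rin_comm, rin_add_right, rin_comm b a, rin_comm b a']

omit [NeZero n] in
/-- The coarse action along a line is an exact parabola: `actC (B + sφ) = actC B + s · D actC(B)[φ] + s² · actC φ`.
[folklore] -/
theorem actC_add_smul (μ ν : Fin d) (B φ : Tor M × Fin d → ℂ) (s : ℝ) :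
    actC n M μ ν (B + (s : ℂ) • φ) = actC n M μ ν B + dActC n M μ ν B φ * s + actC n M μ ν φ * s ^ 2 := by
  simp only [actC, dActC_apply, plaq_add_smul_coarse, normSq_add_smul, Finset.sum_add_distrib, ← Finset.mul_sum]
  ring

omit [NeZero n] in
/-- The exact second-order expansion `actC (B + φ) = actC B + D actC(B)[φ] + actC φ`. [folklore] -/
theorem actC_add (μ ν : Fin d) (B φ : Tor M × Fin d → ℂ) :
    actC n M μ ν (B + φ) = actC n M μ ν B + dActC n M μ ν B φ + actC n M μ ν φ := by
  have h := actC_add_smul n M μ ν B φ 1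
  simpa using h

omit [NeZero n] in
/-- The first variation is additive in the base point. [folklore] -/
theorem dActC_add_base (μ ν : Fin d) (B B' φ : Tor M × Fin d → ℂ) :
    dActC n M μ ν (B + B') φ = dActC n M μ ν B φ + dActC n M μ ν B' φ := by
  simp only [dActC_apply, plaq_add, rin_add_left, Finset.sum_add_distrib]
  ring

omit [NeZero n] in
/-- `D actC(φ)[φ] = 2 · actC φ`. [folklore] -/
theorem dActC_self (μ ν : Fin d) (φ : Tor M × Fin d → ℂ) :
    dActC n M μ ν φ φ = 2 * actC n M μ ν φ := by
  rw [dActC_apply, actC]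
  simp only [rin_self]
  ring

omit [NeZero n] in
/-- Total version of `actC_add`. [folklore] -/
theorem actCtot_add (B φ : Tor M × Fin d → ℂ) :
    actCtot n M (B + φ) = actCtot n M B + dActCtot n M B φ + actCtot n M φ := by
  simp only [actCtot, dActCtot_apply, actC_add, Finset.sum_add_distrib]

omit [NeZero n] in
/-- Total version of `dActC_add_base`. [folklore] -/
theorem dActCtot_add_base (B B' φ : Tor M × Fin d → ℂ) :
    dActCtot n M (B + B') φ = dActCtot n M B φ + dActCtot n M B' φ := by
  simp only [dActCtot_apply, dActC_add_base, Finset.sum_add_distrib]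

omit [NeZero n] in
/-- Total version of `dActC_self`: `D actCtot(φ)[φ] = 2 · actCtot φ`. [folklore] -/
theorem dActCtot_self (φ : Tor M × Fin d → ℂ) :
    dActCtot n M φ φ = 2 * actCtot n M φ := by
  simp only [dActCtot_apply, actCtot, dActC_self, Finset.mul_sum]

omit [NeZero n] in
/-- The total coarse action IS the curvature energy: `actCtot φ = 2 n^d ⟨∂₁φ, ∂₁φ⟩` (B5 (1.66)–(1.67); each unordered
plaquette is counted twice in the sum over ordered planes, matching the `½` in `d1Sq`). [folklore] -/
theorem actCtot_eq_d1Sq (φ : Tor M × Fin d → ℂ) :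
    actCtot n M φ = 2 * (n : ℝ) ^ d * d1Sq M φ := by
  rw [actCtot, Fintype.sum_prod_type, Beta.Ineq167Operator.d1Sq_eq_Fs]
  simp only [actC, Fs_eq_mul_plaq, one_mul, ← Finset.mul_sum]
  ring

omit [NeZero n] in
/-- `0 ≤ actCtot`. [folklore] -/
theorem actCtot_nonneg (B : Tor M × Fin d → ℂ) : 0 ≤ actCtot n M B := by
  rw [actCtot_eq_d1Sq]
  have := d1Sq_nonneg' M B
  positivity

/-- `coarseEnergyNorm φ ^ 2 = ⟨∂₁φ, ∂₁φ⟩`. [folklore] -/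
theorem coarseEnergyNorm_sq (φ : Tor M × Fin d → ℂ) : coarseEnergyNorm M φ ^ 2 = d1Sq M φ := by
  unfold coarseEnergyNorm
  exact Real.sq_sqrt (d1Sq_nonneg' M φ)

omit [NeZero n] in
/-- STRONG CONVEXITY of the coarse quadratic action in the curvature-energy seminorm, as an identity:
`D actCtot(B + φ)[φ] − D actCtot(B)[φ] = 4 n^d ⟨∂₁φ, ∂₁φ⟩`. [folklore] -/
theorem dActCtot_strongConvex (B φ : Tor M × Fin d → ℂ) :
    dActCtot n M (B + φ) φ - dActCtot n M B φ = 4 * (n : ℝ) ^ d * d1Sq M φ := by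
  rw [dActCtot_add_base, dActCtot_self, actCtot_eq_d1Sq]
  ring

/-! ## §2 The one-level coarse problem and Fermat's theorem -/

/-- The admissible set of the ONE-LEVEL coarse problem: `{B : Q′B = V′}`.  No coarse gauge condition is imposed — the
curvature energy, in which the comparison is made, is blind to closed (in particular pure-gauge) directions, and the
rate theorem holds for EVERY minimiser. [folklore] -/
def admissibleC {ι : Type*} (Q' : Matrix ι (Tor M × Fin d) ℂ) (V' : ι → ℂ) : Set (Tor M × Fin d → ℂ) :=
  {B | Q' *ᵥ B = V'}

/-- The one-level admissible set is invariant along `ker Q′`. [folklore] -/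
theorem admissibleC_line {ι : Type*} (Q' : Matrix ι (Tor M × Fin d) ℂ) (V' : ι → ℂ)
    {B φ : Tor M × Fin d → ℂ} (hB : B ∈ admissibleC M Q' V') (hφ : Q' *ᵥ φ = 0) (s : ℝ) :
    B + (s : ℂ) • φ ∈ admissibleC M Q' V' := by
  simp only [admissibleC, Set.mem_setOf_eq] at hB ⊢
  rw [Matrix.mulVec_add, Matrix.mulVec_smul, hφ, smul_zero, add_zero, hB]

omit [NeZero n] in
/-- FERMAT along a line for the coarse action: minimality along `s ↦ B + sφ` forces `D actCtot(B)[φ] = 0`. [folklore] -/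
theorem dActCtot_eq_zero_of_minAlong {B φ : Tor M × Fin d → ℂ}
    (h : ∀ s : ℝ, actCtot n M B ≤ actCtot n M (B + (s : ℂ) • φ)) : dActCtot n M B φ = 0 := by
  have hmin : IsLocalMin (fun s : ℝ => actCtot n M (B + (s : ℂ) • φ)) 0 :=
    Filter.Eventually.of_forall fun s => by simpa using h s
  exact hmin.hasDerivAt_eq_zero (hasDerivAt_actCtot n M B φ)

omit [NeZero n] in
/-- FERMAT for the one-level coarse problem: a minimiser of `actCtot` on `{Q′B = V′}` is critical along `ker Q′`.
[folklore] -/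
theorem dActCtot_eq_zero_of_isMinOn {ι : Type*} (Q' : Matrix ι (Tor M × Fin d) ℂ) (V' : ι → ℂ)
    {B : Tor M × Fin d → ℂ} (hB : B ∈ admissibleC M Q' V') (hmin : IsMinOn (actCtot n M) (admissibleC M Q' V') B)
    {φ : Tor M × Fin d → ℂ} (hφ : Q' *ᵥ φ = 0) : dActCtot n M B φ = 0 :=
  dActCtot_eq_zero_of_minAlong n M fun s => hmin (admissibleC_line M Q' V' hB hφ s)

/-! ## §3 The rate theorem: two-level vs one-level minimisers in the curvature-energy seminorm -/

/-- THE RATE THEOREM (NE3's statement shape in the linear abelian model, fully closed).  Let `Q′` be any complex matrix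
on coarse fields and `V′` any datum.  Let `u` minimise the total fine action `actFtot` on the two-level admissible set
`{w : Q′(Qw) = V′ ∧ R∂ᴴw = 0}` and lie in `critSet μ ν K` for every plane (curvature-gradient level `K`), and let `B₁`
minimise the coarse action `actCtot` on `{B : Q′B = V′}`.  Then the block average `Qu` and `B₁` differ, in the coarse
curvature-energy seminorm `⟨∂₁·, ∂₁·⟩^{1/2}`, by at most `d² · √(2 n^d γ₁(d)) · (2√(6(d+2)) n² K) / (4 n^d)` —
`O(K)` with constants depending on `d` and `n = L` only.  Proof: Fermat for `B₁` on `φ = Qu − B₁ ∈ ker Q′`, the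
two-level residual theorem for `Qu` on the same `φ`, and the strong-convexity identity `dActCtot_strongConvex`.
[folklore] -/
theorem energyDist_twoLevel_oneLevel {ι : Type*} (Q' : Matrix ι (Tor M × Fin d) ℂ) (V' : ι → ℂ) (K : ℝ) (hK : 0 ≤ K)
    {u : Tor (fine n M) × Fin d → ℂ} (huA : u ∈ admissible n M Q' V')
    (hmin : IsMinOn (actFtot n M) (admissible n M Q' V') u) (hu : ∀ μ ν : Fin d, u ∈ critSet n M μ ν K)
    {B₁ : Tor M × Fin d → ℂ} (hB₁ : B₁ ∈ admissibleC M Q' V')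
    (hmin₁ : IsMinOn (actCtot n M) (admissibleC M Q' V') B₁) :
    coarseEnergyNorm M (QvOp n M *ᵥ u - B₁)
      ≤ (d : ℝ) ^ 2 * (Real.sqrt (2 * (n : ℝ) ^ d * gamma1 d) * (2 * Real.sqrt (6 * ((d : ℝ) + 2)) * (n : ℝ) ^ 2 * K))
        / (4 * (n : ℝ) ^ d) := by
  set φ : Tor M × Fin d → ℂ := QvOp n M *ᵥ u - B₁ with hφdef
  set C : ℝ := (d : ℝ) ^ 2 * (Real.sqrt (2 * (n : ℝ) ^ d * gamma1 d)
    * (2 * Real.sqrt (6 * ((d : ℝ) + 2)) * (n : ℝ) ^ 2 * K)) with hCdef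
  have hC : 0 ≤ C := by rw [hCdef]; positivity
  have hnd : (0 : ℝ) < 4 * (n : ℝ) ^ d := by
    have : (0 : ℝ) < (n : ℝ) := by exact_mod_cast Nat.pos_of_ne_zero (NeZero.ne n)
    positivity
  -- `φ ∈ ker Q′`
  have hφ : Q' *ᵥ φ = 0 := by
    have h1 : Q' *ᵥ (QvOp n M *ᵥ u) = V' := huA.1
    have h2 : Q' *ᵥ B₁ = V' := hB₁
    rw [hφdef, Matrix.mulVec_sub, h1, h2, sub_self]
  -- Fermat for the one-level minimiser and the two-level residual theorem, on the same direction `φ`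
  have hF : dActCtot n M B₁ φ = 0 := dActCtot_eq_zero_of_isMinOn n M Q' V' hB₁ hmin₁ hφ
  have hR : |dActCtot n M (QvOp n M *ᵥ u) φ| ≤ C * coarseEnergyNorm M φ :=
    coarseResidual_twoLevel n M Q' V' K hK huA hmin hu hφ
  -- strong convexity: `D actCtot(Qu)[φ] − D actCtot(B₁)[φ] = 4 n^d ⟨∂₁φ, ∂₁φ⟩`
  have hQ : QvOp n M *ᵥ u = B₁ + φ := by rw [hφdef]; abel
  have hSC : dActCtot n M (QvOp n M *ᵥ u) φ = 4 * (n : ℝ) ^ d * coarseEnergyNorm M φ ^ 2 := by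
    rw [coarseEnergyNorm_sq, hQ, ← dActCtot_strongConvex n M B₁ φ, hF, sub_zero]
  -- `4 n^d e² ≤ C e` with `e ≥ 0` ⇒ `e ≤ C / (4 n^d)`
  have he : 0 ≤ coarseEnergyNorm M φ := Real.sqrt_nonneg _
  have hineq : 4 * (n : ℝ) ^ d * coarseEnergyNorm M φ ^ 2 ≤ C * coarseEnergyNorm M φ := by
    rw [← hSC]; exact le_trans (le_abs_self _) hR
  rw [le_div_iff₀ hnd]
  rcases he.lt_or_eq with hpos | hzero
  · have h1 : 4 * (n : ℝ) ^ d * coarseEnergyNorm M φ * coarseEnergyNorm M φ ≤ C * coarseEnergyNorm M φ := by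
      rw [mul_assoc, ← pow_two]; exact hineq
    have h2 : 4 * (n : ℝ) ^ d * coarseEnergyNorm M φ ≤ C := le_of_mul_le_mul_right h1 hpos
    have h3 : coarseEnergyNorm M φ * (4 * (n : ℝ) ^ d) = 4 * (n : ℝ) ^ d * coarseEnergyNorm M φ := by ring
    rw [h3]; exact h2
  · rw [← hzero, zero_mul]; exact hC

/-- The squared form: `⟨∂₁(Qu − B₁), ∂₁(Qu − B₁)⟩ ≤ (C / 4n^d)²`. [folklore] -/
theorem d1Sq_twoLevel_oneLevel {ι : Type*} (Q' : Matrix ι (Tor M × Fin d) ℂ) (V' : ι → ℂ) (K : ℝ) (hK : 0 ≤ K)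
    {u : Tor (fine n M) × Fin d → ℂ} (huA : u ∈ admissible n M Q' V')
    (hmin : IsMinOn (actFtot n M) (admissible n M Q' V') u) (hu : ∀ μ ν : Fin d, u ∈ critSet n M μ ν K)
    {B₁ : Tor M × Fin d → ℂ} (hB₁ : B₁ ∈ admissibleC M Q' V')
    (hmin₁ : IsMinOn (actCtot n M) (admissibleC M Q' V') B₁) :
    d1Sq M (QvOp n M *ᵥ u - B₁)
      ≤ ((d : ℝ) ^ 2 * (Real.sqrt (2 * (n : ℝ) ^ d * gamma1 d) * (2 * Real.sqrt (6 * ((d : ℝ) + 2)) * (n : ℝ) ^ 2 * K))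
        / (4 * (n : ℝ) ^ d)) ^ 2 := by
  rw [← coarseEnergyNorm_sq]
  have h := energyDist_twoLevel_oneLevel n M Q' V' K hK huA hmin hu hB₁ hmin₁
  have he : 0 ≤ coarseEnergyNorm M (QvOp n M *ᵥ u - B₁) := Real.sqrt_nonneg _
  exact pow_le_pow_left₀ he h 2

/-- NON-VACUITY of the rate theorem: for the datum `V′ = 0` the zero fields are admissible minimisers of both problems
(`u = 0` lies in every `critSet K`), so all hypotheses are simultaneously satisfiable for every `Q′`. [folklore] -/
theorem energyDist_twoLevel_oneLevel_nonvacuous {ι : Type*} (Q' : Matrix ι (Tor M × Fin d) ℂ) (K : ℝ) :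
    (0 : Tor (fine n M) × Fin d → ℂ) ∈ admissible n M Q' 0
    ∧ IsMinOn (actFtot n M) (admissible n M Q' 0) 0
    ∧ (∀ μ ν : Fin d, (0 : Tor (fine n M) × Fin d → ℂ) ∈ critSet n M μ ν K)
    ∧ (0 : Tor M × Fin d → ℂ) ∈ admissibleC M Q' 0
    ∧ IsMinOn (actCtot n M) (admissibleC M Q' 0) 0 := by
  obtain ⟨h0A, h0min, h0crit, -⟩ := coarseResidual_twoLevel_nonvacuous n M Q' K
  refine ⟨h0A, h0min, h0crit, ?_, ?_⟩
  · simp [admissibleC]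
  · intro B _
    have h0 : actCtot n M (0 : Tor M × Fin d → ℂ) = 0 := by
      rw [actCtot_eq_d1Sq, Beta.Ineq167Operator.d1Sq_eq_Fs]
      simp [Fs_eq_mul_plaq, plaq_zero]
    rw [Set.mem_setOf_eq, h0]
    exact actCtot_nonneg n M B

end

end Literature.MathematicalPhysics.QuantumFieldTheory.Balaban1983to89.T4AveragingDeficitRate
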